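import Mathlib
import HarnessLib
import HarnessLib.Audit
import Summits.CriticalPhenomena.PercolationContinuityZ3.Theorems.PercNearOneGluingNoHeavyLowerTailHexMSMatchOneAxis

/-!
# Conjecture (MATCH), two adjacent dead classes: the blocker / compensation structure (hp-7 gen 69)

Support file for crux `stmt-CriticalPhenomena-4575` (route `PercNearOneGluingNoHeavy`), hull-port seat `prim-hp-7` (generation 69);
`--supports stmt-CriticalPhenomena-4575`.  No `sorry`.  Memo: `run/shared/lean/prim/prim-hp-7/FROM-prim-hp-7-g69-MATCH-SYMMETRIC.md` §1.

After `…HexMSMatchOneAxis` (dead set on one axis ⟹ (MATCH)), the next case of Conjecture (MATCH) is a complement-closed dead family on TWO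
axis classes, WLOG `A = cl(P ∪ Q)` with `P` dead of label `ℓ` and `Q` dead of label `ℓ + 1`.  Its candidates contain `cl((P ∪ Q) \\ (P ∪ Q))`
EXCEPT the cross differences that happen to be members ('blockers'); this file proves the rigid structure of that situation used by the gen-69
conjecture V-b (memo §0 (V), §1; exact for n ≤ 5):

* `inter_nonempty_of_dead_of_close`, `union_ne_of_dead_of_close`, `not_subset_of_dead_of_not_close`, `not_superset_of_dead_of_not_close` —
  a dead member meets every close member, covers `U` with none, and is incomparable with every far member;
* `label_sdiff_of_dead_adjacent` — FORCED LABELS: if `p \ q ∈ 𝒟` then `x (p \ q) = x p + 5`, and if `q \ p ∈ 𝒟` then `x (q \ p) = x p + 2`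
  (`label_sdiff_of_dead_adjacent'`); `sdiff_mem_symGen_of_adjacent` — blockers are alive (far meets);
* `inter_mem_candidates_of_sdiff_mem`, `union_mem_candidates_of_sdiff_mem` (and the primed versions for the other blocker kind) — COMPENSATION:
  a blocked pair `(p, q)` makes `p ∩ q` and `p ∪ q` far products of `p` resp. `q` (partners `U \ (p \ q)` and `p \ q`), hence candidates when absent.
-/

namespace Summit.CriticalPhenomena.PercolationContinuityZ3.Theorems

namespace GeneratedDonors

open Finset

variable {α : Type*} [DecidableEq α]
variable {U : Finset α} {𝒟 : Finset (Finset α)} {x : Finset α → ZMod 6}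

section DeadGeometry

/-- A dead member meets every member with a close label. -/
theorem inter_nonempty_of_dead_of_close {s t : Finset α} (hs : s ∈ dead U 𝒟 x) (ht : t ∈ 𝒟)
    (hcl : Close (x s) (x t)) : (s ∩ t).Nonempty := by
  rw [nonempty_iff_ne_empty]
  intro h
  exact (mem_filter.mp hs).2 (mem_symGen_of_disjoint_close (mem_filter.mp hs).1 ht (disjoint_iff_inter_eq_empty.mpr h) hcl)

/-- A dead member contains no member with a far label. -/
theorem not_subset_of_dead_of_not_close (hU : ∀ a ∈ 𝒟, a ⊆ U) (hco : ∀ a ∈ 𝒟, U \ a ∈ 𝒟)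
    (hanti : ∀ a ∈ 𝒟, x (U \ a) = x a + 3) {s t : Finset α} (hs : s ∈ dead U 𝒟 x) (ht : t ∈ 𝒟)
    (hfar : ¬ Close (x t) (x s)) : ¬ t ⊆ s := fun hts =>
  (mem_filter.mp hs).2 (mem_symGen_of_subset_far hU hco hanti (mem_filter.mp hs).1 ht hts hfar)

/-- A dead member is contained in no member with a far label. -/
theorem not_superset_of_dead_of_not_close (hU : ∀ a ∈ 𝒟, a ⊆ U) (hco : ∀ a ∈ 𝒟, U \ a ∈ 𝒟)
    (hanti : ∀ a ∈ 𝒟, x (U \ a) = x a + 3) {s t : Finset α} (hs : s ∈ dead U 𝒟 x) (ht : t ∈ 𝒟)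
    (hfar : ¬ Close (x t) (x s)) : ¬ s ⊆ t := by
  intro hst
  -- pass to complements: U \ t ⊆ U \ s, U \ s dead, labels still far
  have hsD : s ∈ 𝒟 := (mem_filter.mp hs).1
  have h1 : U \ t ⊆ U \ s := sdiff_subset_sdiff subset_rfl hst
  have hfar' : ¬ Close (x (U \ t)) (x (U \ s)) := by
    rw [hanti t ht, hanti s hsD, close_add_three_iff]; exact hfar
  exact not_subset_of_dead_of_not_close hU hco hanti (compl_mem_dead hU hco hs) (hco t ht) hfar' h1

/-- A dead member together with a close member never covers `U`. -/
theorem union_ne_of_dead_of_close (hU : ∀ a ∈ 𝒟, a ⊆ U) (hco : ∀ a ∈ 𝒟, U \ a ∈ 𝒟)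
    (hanti : ∀ a ∈ 𝒟, x (U \ a) = x a + 3) {s t : Finset α} (hs : s ∈ dead U 𝒟 x) (ht : t ∈ 𝒟)
    (hcl : Close (x s) (x t)) : s ∪ t ≠ U := by
  intro h
  -- then U \ t ⊆ s with U \ t far from s
  have hsub : U \ t ⊆ s := by
    intro i hi
    rw [mem_sdiff] at hi
    have : i ∈ s ∪ t := by rw [h]; exact hi.1
    rcases mem_union.mp this with h' | h'
    · exact h'
    · exact absurd h' hi.2
  have hfar : ¬ Close (x (U \ t)) (x s) := by
    rw [hanti t ht, close_add_three_iff_not_close, not_not, close_comm]; exact hcl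
  exact not_subset_of_dead_of_not_close hU hco hanti hs (hco t ht) hfar hsub

end DeadGeometry

section Blockers

/-- Label arithmetic: a label close to `ℓ` and far from `ℓ + 1` is `ℓ + 5`. -/
theorem eq_add_five_of_close_of_not_close {ℓ s : ZMod 6} (h1 : Close s ℓ) (h2 : ¬ Close (ℓ + 1) s) : s = ℓ + 5 := by
  revert ℓ s; decide

/-- Label arithmetic: a label close to `ℓ + 1` and far from `ℓ` is `ℓ + 2`. -/
theorem eq_add_two_of_close_of_not_close {ℓ s : ZMod 6} (h1 : Close s (ℓ + 1)) (h2 : ¬ Close ℓ s) : s = ℓ + 2 := by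
  revert ℓ s; decide

/-- **Forced label of a blocker (first kind).**  If `p, q` are dead with `x q = x p + 1` and `p \ q` is a member, then `x (p \ q) = x p + 5`:
it lies inside `p` (so it is close to `x p`) and is disjoint from `q` (so it is far from `x q`). -/
theorem label_sdiff_of_dead_adjacent (hU : ∀ a ∈ 𝒟, a ⊆ U) (hco : ∀ a ∈ 𝒟, U \ a ∈ 𝒟)
    (hanti : ∀ a ∈ 𝒟, x (U \ a) = x a + 3) {p q : Finset α} (hp : p ∈ dead U 𝒟 x) (hq : q ∈ dead U 𝒟 x)
    (hlab : x q = x p + 1) (hmem : p \ q ∈ 𝒟) : x (p \ q) = x p + 5 := by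
  have h1 : Close (x (p \ q)) (x p) := by
    by_contra h
    exact not_subset_of_dead_of_not_close hU hco hanti hp hmem h sdiff_subset
  have h2 : ¬ Close (x q) (x (p \ q)) := fun h =>
    (mem_filter.mp hq).2 (mem_symGen_of_disjoint_close (mem_filter.mp hq).1 hmem disjoint_sdiff_self_right h)
  rw [hlab] at h2
  exact eq_add_five_of_close_of_not_close h1 h2

/-- **Forced label of a blocker (second kind).**  If `p, q` are dead with `x q = x p + 1` and `q \ p` is a member, then `x (q \ p) = x p + 2`. -/
theorem label_sdiff_of_dead_adjacent' (hU : ∀ a ∈ 𝒟, a ⊆ U) (hco : ∀ a ∈ 𝒟, U \ a ∈ 𝒟)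
    (hanti : ∀ a ∈ 𝒟, x (U \ a) = x a + 3) {p q : Finset α} (hp : p ∈ dead U 𝒟 x) (hq : q ∈ dead U 𝒟 x)
    (hlab : x q = x p + 1) (hmem : q \ p ∈ 𝒟) : x (q \ p) = x p + 2 := by
  have h1 : Close (x (q \ p)) (x q) := by
    by_contra h
    exact not_subset_of_dead_of_not_close hU hco hanti hq hmem h sdiff_subset
  have h2 : ¬ Close (x p) (x (q \ p)) := fun h =>
    (mem_filter.mp hp).2 (mem_symGen_of_disjoint_close (mem_filter.mp hp).1 hmem disjoint_sdiff_self_right h)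
  rw [hlab] at h1
  exact eq_add_two_of_close_of_not_close h1 h2

/-- Labels `ℓ` and `ℓ + 1 + 3` are far. -/
theorem not_close_add_one_add_three (ℓ : ZMod 6) : ¬ Close ℓ (ℓ + 1 + 3) := by
  revert ℓ; decide

/-- **Blockers are alive**: for members `p, q` with `x q = x p + 1`, the difference `p \ q = p ∩ (U \ q)` is a far meet, hence in `symGen`. -/
theorem sdiff_mem_symGen_of_adjacent (hU : ∀ a ∈ 𝒟, a ⊆ U) (hco : ∀ a ∈ 𝒟, U \ a ∈ 𝒟)
    (hanti : ∀ a ∈ 𝒟, x (U \ a) = x a + 3) {p q : Finset α} (hp : p ∈ 𝒟) (hq : q ∈ 𝒟)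
    (hlab : x q = x p + 1) : p \ q ∈ symGen U 𝒟 x := by
  have hfar : ¬ Close (x p) (x (U \ q)) := by rw [hanti q hq, hlab]; exact not_close_add_one_add_three (x p)
  have hsd : p \ q = p ∩ (U \ q) := by
    have h1 := sdiff_univ_compl_eq_inter (U := U) (f := U \ q) (hU p hp)
    rw [Finset.sdiff_sdiff_eq_self (hU q hq)] at h1
    exact h1
  refine farProducts_subset_symGen hU hco hanti hp (mem_farProducts.mpr ⟨U \ q, hco q hq, hfar, Or.inl hsd⟩)

/-- **Compensation, meet (first kind).**  If `p \ q ∈ 𝒟` (a blocker) then `p ∩ q` is a far product of `p` — with the partner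
`U \ (p \ q)` of label `x p + 2` — hence a candidate of `p` as soon as it is not a member. -/
theorem inter_mem_candidates_of_sdiff_mem (hU : ∀ a ∈ 𝒟, a ⊆ U) (hco : ∀ a ∈ 𝒟, U \ a ∈ 𝒟)
    (hanti : ∀ a ∈ 𝒟, x (U \ a) = x a + 3) {p q : Finset α} (hp : p ∈ dead U 𝒟 x) (hq : q ∈ dead U 𝒟 x)
    (hlab : x q = x p + 1) (hmem : p \ q ∈ 𝒟) (habs : p ∩ q ∉ 𝒟) : p ∩ q ∈ candidates 𝒟 x p := by
  have hpD : p ∈ 𝒟 := (mem_filter.mp hp).1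
  have h8 : ∀ s : ZMod 6, s + 5 + 3 = s + 2 := by decide
  have hγ : x (U \ (p \ q)) = x p + 2 := by
    rw [hanti _ hmem, label_sdiff_of_dead_adjacent hU hco hanti hp hq hlab hmem, h8]
  have hfar : ¬ Close (x p) (x (U \ (p \ q))) := by
    rw [hγ]; have key : ∀ s : ZMod 6, ¬ Close s (s + 2) := by decide
    exact key _
  have hset : p ∩ q = p ∩ (U \ (p \ q)) := by
    ext i
    simp only [mem_inter, mem_sdiff, not_and, not_not]
    constructor
    · intro ⟨hip, hiq⟩; exact ⟨hip, hU p hpD hip, fun _ => hiq⟩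
    · intro ⟨hip, _, h⟩; exact ⟨hip, h hip⟩
  unfold candidates
  rw [mem_sdiff]
  exact ⟨mem_farProducts.mpr ⟨U \ (p \ q), hco _ hmem, hfar, Or.inl hset⟩, habs⟩

/-- **Compensation, join (first kind).**  If `p \ q ∈ 𝒟` then `p ∪ q = q ∪ (p \ q)` is a far join of `q` (labels `x p + 1`, `x p + 5`),
hence a candidate of `q` when it is not a member. -/
theorem union_mem_candidates_of_sdiff_mem (hU : ∀ a ∈ 𝒟, a ⊆ U) (hco : ∀ a ∈ 𝒟, U \ a ∈ 𝒟)
    (hanti : ∀ a ∈ 𝒟, x (U \ a) = x a + 3) {p q : Finset α} (hp : p ∈ dead U 𝒟 x) (hq : q ∈ dead U 𝒟 x)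
    (hlab : x q = x p + 1) (hmem : p \ q ∈ 𝒟) (habs : p ∪ q ∉ 𝒟) : p ∪ q ∈ candidates 𝒟 x q := by
  have hfar : ¬ Close (x q) (x (p \ q)) := by
    rw [hlab, label_sdiff_of_dead_adjacent hU hco hanti hp hq hlab hmem]
    have key : ∀ s : ZMod 6, ¬ Close (s + 1) (s + 5) := by decide
    exact key _
  have hset : p ∪ q = q ∪ (p \ q) := by rw [union_comm q, sdiff_union_self_eq_union]
  unfold candidates
  rw [mem_sdiff]
  exact ⟨mem_farProducts.mpr ⟨p \ q, hmem, hfar, Or.inr hset⟩, habs⟩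

/-- **Compensation, join (second kind).**  If `q \ p ∈ 𝒟` then `p ∪ q = p ∪ (q \ p)` is a far join of `p` (labels `x p`, `x p + 2`). -/
theorem union_mem_candidates_of_sdiff_mem' (hU : ∀ a ∈ 𝒟, a ⊆ U) (hco : ∀ a ∈ 𝒟, U \ a ∈ 𝒟)
    (hanti : ∀ a ∈ 𝒟, x (U \ a) = x a + 3) {p q : Finset α} (hp : p ∈ dead U 𝒟 x) (hq : q ∈ dead U 𝒟 x)
    (hlab : x q = x p + 1) (hmem : q \ p ∈ 𝒟) (habs : p ∪ q ∉ 𝒟) : p ∪ q ∈ candidates 𝒟 x p := by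
  have hfar : ¬ Close (x p) (x (q \ p)) := by
    rw [label_sdiff_of_dead_adjacent' hU hco hanti hp hq hlab hmem]
    have key : ∀ s : ZMod 6, ¬ Close s (s + 2) := by decide
    exact key _
  have hset : p ∪ q = p ∪ (q \ p) := by rw [union_sdiff_self_eq_union]
  unfold candidates
  rw [mem_sdiff]
  exact ⟨mem_farProducts.mpr ⟨q \ p, hmem, hfar, Or.inr hset⟩, habs⟩

/-- **Compensation, meet (second kind).**  If `q \ p ∈ 𝒟` then `p ∩ q = q ∩ (U \ (q \ p))` is a far meet of `q` (labels `x p + 1`,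
`x p + 5`), hence a candidate of `q` when absent. -/
theorem inter_mem_candidates_of_sdiff_mem' (hU : ∀ a ∈ 𝒟, a ⊆ U) (hco : ∀ a ∈ 𝒟, U \ a ∈ 𝒟)
    (hanti : ∀ a ∈ 𝒟, x (U \ a) = x a + 3) {p q : Finset α} (hp : p ∈ dead U 𝒟 x) (hq : q ∈ dead U 𝒟 x)
    (hlab : x q = x p + 1) (hmem : q \ p ∈ 𝒟) (habs : p ∩ q ∉ 𝒟) : p ∩ q ∈ candidates 𝒟 x q := by
  have hqD : q ∈ 𝒟 := (mem_filter.mp hq).1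
  have hγ : x (U \ (q \ p)) = x p + 5 := by
    rw [hanti _ hmem, label_sdiff_of_dead_adjacent' hU hco hanti hp hq hlab hmem]; ring
  have hfar : ¬ Close (x q) (x (U \ (q \ p))) := by
    rw [hγ, hlab]; have key : ∀ s : ZMod 6, ¬ Close (s + 1) (s + 5) := by decide
    exact key _
  have hset : p ∩ q = q ∩ (U \ (q \ p)) := by
    ext i
    simp only [mem_inter, mem_sdiff, not_and, not_not]
    constructor
    · intro ⟨hip, hiq⟩; exact ⟨hiq, hU q hqD hiq, fun _ => hip⟩
    · intro ⟨hiq, _, h⟩; exact ⟨h hiq, hiq⟩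
  unfold candidates
  rw [mem_sdiff]
  exact ⟨mem_farProducts.mpr ⟨U \ (q \ p), hco _ hmem, hfar, Or.inl hset⟩, habs⟩

/-- `U \ ((U \ s) \ t) = s ∪ t` for `s, t ⊆ U`. -/
theorem compl_compl_sdiff_eq_union {U s t : Finset α} (hs : s ⊆ U) (ht : t ⊆ U) : U \ ((U \ s) \ t) = s ∪ t := by
  ext i
  simp only [mem_sdiff, mem_union]
  have := @hs i; have := @ht i
  tauto

/-- **A far join of two members is generated**: if `a, b ∈ 𝒟` have far labels then `a ∪ b ∈ symGen U 𝒟 x` (`a ∪ b = U \ ((U \ a) \ b)` and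
`U \ a` is close to `b`). -/
theorem union_mem_symGen_of_not_close (hU : ∀ a ∈ 𝒟, a ⊆ U) (hco : ∀ a ∈ 𝒟, U \ a ∈ 𝒟)
    (hanti : ∀ a ∈ 𝒟, x (U \ a) = x a + 3) {a b : Finset α} (ha : a ∈ 𝒟) (hb : b ∈ 𝒟)
    (hfar : ¬ Close (x a) (x b)) : a ∪ b ∈ symGen U 𝒟 x := by
  have hgen : (U \ a) \ b ∈ gen 𝒟 x := by
    refine mem_gen.mpr ⟨U \ a, hco a ha, b, hb, ?_, rfl⟩
    rw [hanti a ha]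
    exact (close_add_three_iff_not_close _ _).mpr hfar
  unfold symGen
  exact mem_union_right _ (mem_image.mpr ⟨_, hgen, compl_compl_sdiff_eq_union (hU a ha) (hU b hb)⟩)

/-- **Both blockers present ⟹ the meet is absent.**  If `p \ q ∈ 𝒟` and `q \ p ∈ 𝒟` then `p ∩ q ∉ 𝒟`: a member `p ∩ q` is close to
both `x p` and `x p + 1` (it lies inside both dead members), hence far from one of the blocker labels `x p + 5`, `x p + 2`, exhibiting `p` or `q`
as a far join of two members. -/
theorem inter_notMem_of_both_sdiff_mem (hU : ∀ a ∈ 𝒟, a ⊆ U) (hco : ∀ a ∈ 𝒟, U \ a ∈ 𝒟)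
    (hanti : ∀ a ∈ 𝒟, x (U \ a) = x a + 3) {p q : Finset α} (hp : p ∈ dead U 𝒟 x) (hq : q ∈ dead U 𝒟 x)
    (hlab : x q = x p + 1) (h1 : p \ q ∈ 𝒟) (h2 : q \ p ∈ 𝒟) : p ∩ q ∉ 𝒟 := by
  intro hc
  have hl1 := label_sdiff_of_dead_adjacent hU hco hanti hp hq hlab h1
  have hl2 := label_sdiff_of_dead_adjacent' hU hco hanti hp hq hlab h2
  have hcp : Close (x (p ∩ q)) (x p) := by
    by_contra h; exact not_subset_of_dead_of_not_close hU hco hanti hp hc h inter_subset_left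
  have hcq : Close (x (p ∩ q)) (x q) := by
    by_contra h; exact not_subset_of_dead_of_not_close hU hco hanti hq hc h inter_subset_right
  have key : ∀ ℓ c : ZMod 6, Close c ℓ → Close c (ℓ + 1) → (¬ Close (ℓ + 5) c) ∨ (¬ Close (ℓ + 2) c) := by decide
  rcases key (x p) (x (p ∩ q)) hcp (by rw [← hlab]; exact hcq) with h | h
  · apply (mem_filter.mp hp).2
    have := union_mem_symGen_of_not_close hU hco hanti h1 hc (by rw [hl1]; exact h)
    rwa [sdiff_union_inter] at this
  · apply (mem_filter.mp hq).2
    have := union_mem_symGen_of_not_close hU hco hanti h2 hc (by rw [hl2]; exact h)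
    rwa [inter_comm, sdiff_union_inter] at this

end Blockers

end GeneratedDonors

end Summit.CriticalPhenomena.PercolationContinuityZ3.Theorems
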